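import Mathlib
import HarnessLib

/-!
# Saddle geometry on the fugacity torus, part 4: the logarithmic slice `u ↦ log(1 + z₀e^{iu})`

Helper file for route `TcThermcert1`, crux `ThermalStiffnessCeilingU8b10_le_1o8` (item `stmt-Ventures-26381`), line
`Cruxes/ThermalStiffnessCeilingU8b10_le_1o8/Lines/zerofree_corridor.lean` v8, registered stub `stub_saddleGeometry` (K3b).

The separable part of the exponent along the torus through the critical point `z₀ = r₁e^{iφ₀}` is the slice
`A(u) = log(1 + z₀e^{iu})`, a complex-analytic function of COMPLEX `u` as long as `‖z₀‖e^{|Im u|} < 1`.  This file records the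
model-specific calculus the K3b prover feeds into `cauchy_taylor_two` (part 3):

* `hasDerivAt_logCircle`, `hasDerivAt_logCircle_deriv`: `A'(u) = i z₀e^{iu}/(1+z₀e^{iu})`, `A''(u) = −z₀e^{iu}/(1+z₀e^{iu})²`;
* `deriv_logCircle_zero`: `A'(0) = i z₀/(1+z₀)`, `A''(0) = −z₀/(1+z₀)²` (as `deriv` / `iteratedDeriv 2`), `‖z₀‖ < 1`;
* `differentiableOn_logCircle`, `norm_logCircle_le`: `A` is complex differentiable on `‖u‖ ≤ R₀` and bounded there by
  `κ²/(2(1−κ)) + κ`, `κ = ‖z₀‖e^{R₀} < 1` (from `‖z₀e^{iu}‖ = ‖z₀‖e^{−Im u}`);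
* `norm_slice_mem_annulus`: along `ζ ↦ z₀e^{iζc}` (`|c| ≤ 1`, `‖ζ‖ ≤ 1/20`) a base point with `13/18 ≤ ‖z₀‖ ≤ 15/18`
  (the bidisc of part 2) stays in the fugacity annulus `2/3 < |z| < 8/9` — so the `h`-slices `ζ ↦ h(z₀e^{iζu/m}, w₀e^{iζv/m})` are defined
  and analytic on `‖ζ‖ ≤ 1/20`;
* `logCircle_re`: for real `u`, `Re A(u) = log|1 + z₀e^{iu}|` (link to the angular profile of part 1).

[folklore] No definitions; no `sorry`.
-/

noncomputable section

open Complex Metric Set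

namespace Summit.Ventures.CertifiedManyBodySolver.Theorems.TcThermcert1.ZeroFreeCorridor

/-! ## §5 The logarithmic slice `u ↦ log(1 + z₀e^{iu})` for complex `u` -/

/-- `‖z₀ e^{iu}‖ = ‖z₀‖ e^{-Im u}`. -/
theorem norm_mul_cexp_mul_I (z₀ u : ℂ) : ‖z₀ * cexp (u * I)‖ = ‖z₀‖ * Real.exp (-u.im) := by
  rw [norm_mul, Complex.norm_exp]
  simp

/-- On the disc `‖u‖ ≤ R₀`: `‖z₀ e^{iu}‖ ≤ ‖z₀‖ e^{R₀}`. -/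
theorem norm_mul_cexp_mul_I_le {z₀ u : ℂ} {R₀ : ℝ} (hu : ‖u‖ ≤ R₀) :
    ‖z₀ * cexp (u * I)‖ ≤ ‖z₀‖ * Real.exp R₀ := by
  rw [norm_mul_cexp_mul_I]
  gcongr
  exact (neg_le_abs _).trans ((Complex.abs_im_le_norm u).trans hu)

/-- First derivative of the logarithmic slice: `d/du log(1 + z₀e^{iu}) = i z₀e^{iu}/(1 + z₀e^{iu})` wherever `‖z₀e^{iu}‖ < 1`. -/
theorem hasDerivAt_logCircle {z₀ u : ℂ} (h : ‖z₀ * cexp (u * I)‖ < 1) :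
    HasDerivAt (fun u : ℂ => Complex.log (1 + z₀ * cexp (u * I)))
      (I * (z₀ * cexp (u * I)) / (1 + z₀ * cexp (u * I))) u := by
  have h1 : HasDerivAt (fun u : ℂ => cexp (u * I)) (cexp (u * I) * (1 * I)) u :=
    (Complex.hasDerivAt_exp (u * I)).comp u ((hasDerivAt_id u).mul_const I)
  have h2 : HasDerivAt (fun u : ℂ => 1 + z₀ * cexp (u * I)) (z₀ * (cexp (u * I) * (1 * I))) u :=
    (h1.const_mul z₀).const_add 1
  have h3 := h2.clog (Complex.mem_slitPlane_of_norm_lt_one h)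
  convert h3 using 1
  ring

/-- Second derivative of the logarithmic slice: `d/du [i z₀e^{iu}/(1 + z₀e^{iu})] = −z₀e^{iu}/(1 + z₀e^{iu})²`. -/
theorem hasDerivAt_logCircle_deriv {z₀ u : ℂ} (h : 1 + z₀ * cexp (u * I) ≠ 0) :
    HasDerivAt (fun u : ℂ => I * (z₀ * cexp (u * I)) / (1 + z₀ * cexp (u * I)))
      (-(z₀ * cexp (u * I)) / (1 + z₀ * cexp (u * I)) ^ 2) u := by
  have h1 : HasDerivAt (fun u : ℂ => cexp (u * I)) (cexp (u * I) * (1 * I)) u :=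
    (Complex.hasDerivAt_exp (u * I)).comp u ((hasDerivAt_id u).mul_const I)
  have hN : HasDerivAt (fun u : ℂ => I * (z₀ * cexp (u * I))) (I * (z₀ * (cexp (u * I) * (1 * I)))) u :=
    (h1.const_mul z₀).const_mul I
  have hD : HasDerivAt (fun u : ℂ => 1 + z₀ * cexp (u * I)) (z₀ * (cexp (u * I) * (1 * I))) u :=
    (h1.const_mul z₀).const_add 1
  refine (hN.div hD h).congr_deriv ?_
  rw [div_left_inj' (pow_ne_zero 2 h)]
  linear_combination (z₀ * cexp (u * I)) * Complex.I_mul_I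

/-- The logarithmic slice is complex differentiable on the closed disc `‖u‖ ≤ R₀` as soon as `‖z₀‖e^{R₀} < 1`. -/
theorem differentiableOn_logCircle {z₀ : ℂ} {R₀ : ℝ} (hκ : ‖z₀‖ * Real.exp R₀ < 1) :
    DifferentiableOn ℂ (fun u : ℂ => Complex.log (1 + z₀ * cexp (u * I))) (closedBall 0 R₀) := fun _ hu =>
  (hasDerivAt_logCircle ((norm_mul_cexp_mul_I_le (mem_closedBall_zero_iff.mp hu)).trans_lt hκ)).differentiableAt
    |>.differentiableWithinAt

/-- Sup bound of the logarithmic slice on `‖u‖ ≤ R₀`: with `κ = ‖z₀‖e^{R₀} < 1`,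
`‖log(1 + z₀e^{iu})‖ ≤ κ²/(2(1−κ)) + κ`. -/
theorem norm_logCircle_le {z₀ u : ℂ} {R₀ : ℝ} (hκ : ‖z₀‖ * Real.exp R₀ < 1) (hu : ‖u‖ ≤ R₀) :
    ‖Complex.log (1 + z₀ * cexp (u * I))‖ ≤
      (‖z₀‖ * Real.exp R₀) ^ 2 * (1 - ‖z₀‖ * Real.exp R₀)⁻¹ / 2 + ‖z₀‖ * Real.exp R₀ := by
  have hle := norm_mul_cexp_mul_I_le (z₀ := z₀) hu
  have hlt := hle.trans_lt hκ
  refine (Complex.norm_log_one_add_le hlt).trans ?_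
  have h0 := norm_nonneg (z₀ * cexp (u * I))
  have h1 : 0 < 1 - ‖z₀‖ * Real.exp R₀ := by linarith
  gcongr

/-- Values at the base point: `A'(0) = i z₀/(1+z₀)` and `A''(0) = −z₀/(1+z₀)²` for the slice `A(u) = log(1 + z₀e^{iu})`,
`‖z₀‖ < 1`. -/
theorem deriv_logCircle_zero {z₀ : ℂ} (hz : ‖z₀‖ < 1) :
    deriv (fun u : ℂ => Complex.log (1 + z₀ * cexp (u * I))) 0 = I * z₀ / (1 + z₀) ∧
    iteratedDeriv 2 (fun u : ℂ => Complex.log (1 + z₀ * cexp (u * I))) 0 = -z₀ / (1 + z₀) ^ 2 := by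
  -- a radius `R₀ > 0` with `‖z₀‖ e^{R₀} < 1`
  obtain ⟨R₀, hR₀, hκ⟩ : ∃ R₀ : ℝ, 0 < R₀ ∧ ‖z₀‖ * Real.exp R₀ < 1 := by
    rcases eq_or_lt_of_le (norm_nonneg z₀) with h0 | h0
    · exact ⟨1, one_pos, by rw [← h0]; simp⟩
    · refine ⟨Real.log (2 / (1 + ‖z₀‖)) , Real.log_pos (by rw [lt_div_iff₀ (by linarith)]; linarith), ?_⟩
      rw [Real.exp_log (by positivity)]
      rw [mul_div_assoc', div_lt_one (by linarith)]
      linarith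
  have hev : ∀ u ∈ ball (0 : ℂ) R₀, ‖z₀ * cexp (u * I)‖ < 1 := fun u hu =>
    (norm_mul_cexp_mul_I_le (mem_ball_zero_iff.mp hu).le).trans_lt hκ
  have hderiv : deriv (fun u : ℂ => Complex.log (1 + z₀ * cexp (u * I))) =ᶠ[nhds 0]
      fun u => I * (z₀ * cexp (u * I)) / (1 + z₀ * cexp (u * I)) := by
    filter_upwards [isOpen_ball.mem_nhds (mem_ball_self hR₀)] with u hu
    exact (hasDerivAt_logCircle (hev u hu)).deriv
  have hz0 : ‖z₀ * cexp (0 * I)‖ < 1 := by simpa using hz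
  constructor
  · rw [(hasDerivAt_logCircle hz0).deriv]; simp [mul_div_assoc]
  · rw [iteratedDeriv_succ, iteratedDeriv_one, hderiv.deriv_eq]
    have hne : 1 + z₀ * cexp (0 * I) ≠ 0 := Complex.slitPlane_ne_zero (Complex.mem_slitPlane_of_norm_lt_one hz0)
    rw [(hasDerivAt_logCircle_deriv hne).deriv]; simp

/-- Along a complex slice `ζ ↦ z₀e^{iζc}` (`|c| ≤ 1`, `‖ζ‖ ≤ 1/20`) a base point with `13/18 ≤ ‖z₀‖ ≤ 15/18` (the bidisc of
part 2) stays inside the fugacity annulus `2/3 < |z| < 8/9`. -/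
theorem norm_slice_mem_annulus {z₀ ζ : ℂ} {c : ℝ} (hz : 13 / 18 ≤ ‖z₀‖) (hz' : ‖z₀‖ ≤ 15 / 18) (hc : |c| ≤ 1)
    (hζ : ‖ζ‖ ≤ 1 / 20) :
    2 / 3 < ‖z₀ * cexp (ζ * c * I)‖ ∧ ‖z₀ * cexp (ζ * c * I)‖ < 8 / 9 := by
  rw [norm_mul_cexp_mul_I]
  have him : |(ζ * (c : ℂ)).im| ≤ 1 / 20 := by
    rw [Complex.mul_im, Complex.ofReal_re, Complex.ofReal_im, mul_zero, zero_add, abs_mul]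
    calc |ζ.im| * |c| ≤ ‖ζ‖ * 1 := by
          gcongr
          · exact Complex.abs_im_le_norm ζ
      _ ≤ 1 / 20 := by linarith
  have hx := abs_le.mp him
  -- `e^{1/20} ≤ 1 + 1/20 + 1/400` and `e^{-x} ≥ 1 - x`
  have hup : Real.exp (-(ζ * (c : ℂ)).im) ≤ 1 + 1 / 20 + 1 / 400 := by
    have h1 : Real.exp (-(ζ * (c : ℂ)).im) ≤ Real.exp (1 / 20) := Real.exp_le_exp.mpr (by linarith [hx.1])
    have h2 := Real.abs_exp_sub_one_sub_id_le (x := 1 / 20) (by rw [abs_le]; constructor <;> norm_num)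
    have h3 := (abs_le.mp h2).2
    nlinarith
  have hlo : 1 - 1 / 20 ≤ Real.exp (-(ζ * (c : ℂ)).im) := by
    have h1 := Real.add_one_le_exp (-(ζ * (c : ℂ)).im)
    linarith [hx.2]
  constructor <;> nlinarith [Real.exp_pos (-(ζ * (c : ℂ)).im)]

/-- For real `u` the real part of the slice is `log|1 + z₀e^{iu}|`. -/
theorem logCircle_re (z₀ : ℂ) (u : ℝ) :
    (Complex.log (1 + z₀ * cexp ((u : ℂ) * I))).re = Real.log ‖1 + z₀ * cexp ((u : ℂ) * I)‖ :=
  Complex.log_re _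

end Summit.Ventures.CertifiedManyBodySolver.Theorems.TcThermcert1.ZeroFreeCorridor

end
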